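import Mathlib.RingTheory.Valuation.ValuationSubring
import Mathlib.RingTheory.LocalRing.ResidueField.Basic
import Mathlib.Algebra.BigOperators.Group.Finset.Basic
import Mathlib.Logic.Function.Basic
import Summits.ResolutionOfSingularities.ResolutionOfSingularities.Theorems.ValuativeLuAlphaPTorsorAPDict
import HarnessLib

/-!
# The residual chart of an adapted chart — general helpers (residues of units, re-indexing)

Crux `Valuative.LuAlphaPTorsor` (stmt-ResolutionOfSingularities-0641), line
`pfaff-line-log-final-forms`, stub `stub_residualChart` (F⁴ᵇ, reshape v6.3: the rank `≥ 2`
Abhyankar core via FLAG-ADAPTED very good charts). For a composite valuation `O ≤ W` of `K`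
(`ν_O = ν_W ∘ ν̄`, `ν̄` the valuation of `κ(W)` with ring `Ō = residueValuationSubring O W _`,
`CompositeValuations.lean`) this file proves the DICTIONARY between `Ō`-values of residues of
`W`-units and `O`-values for LAURENT MONOMIALS, extending `ap_resval_le_iff` / `ap_resval_lt_iff`
of `…APDict` (`ν̄(ȳ) ≤ ν̄(ȳ') ↔ ν(y) ≤ ν(y')` for `y ∈ W`, `y'` a `W`-unit):
`residChart_residue_prod_zpow` (the residue of a monomial in units is the monomial of the
residues), `residChart_prod_val_residue_le_iff` / `…_lt_iff` / `residChart_val_residue_lt_prod_iff`;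
the lower parameters of a coarsening `W ⊇ O` cut out by Laurent monomials in parameters `x` are
`W`-units (`residChart_val_param_eq_one`); and the re-indexing of exponents along an enumeration
`e : Fin nS ≃ {i // P i}` of part of the parameters (`residChart_prod_extend`, extension by `0`).
Folklore valuation theory (Zariski–Samuel II, Ch. VI §10; Bourbaki AC VI §4).
-/

set_option linter.dupNamespace false

noncomputable section

open IsLocalRing Literature.AlgebraicGeometry.Resolution

namespace Summit.ResolutionOfSingularities.ResolutionOfSingularities.Theorems.PfaffLine

/-! ### Laurent monomials -/

section Monomials

variable {Γ₀ : Type*} [CommGroupWithZero Γ₀] {ι : Type*} [Fintype ι]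

/-- `τ^(-m) = (τ^m)⁻¹`. [folklore] -/
theorem residChart_prod_zpow_neg (τ : ι → Γ₀) (m : ι → ℤ) :
    ∏ i, τ i ^ ((-m) i) = (∏ i, τ i ^ (m i))⁻¹ := by
  rw [← Finset.prod_inv_distrib]
  exact Finset.prod_congr rfl fun i _ => by rw [Pi.neg_apply, zpow_neg]

/-- `τ^(N • m) = (τ^m)^N`. [folklore] -/
theorem residChart_prod_zpow_nsmul (τ : ι → Γ₀) (N : ℕ) (m : ι → ℤ) :
    ∏ i, τ i ^ (((N : ℤ) • m) i) = (∏ i, τ i ^ (m i)) ^ N := by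
  rw [← Finset.prod_pow]
  exact Finset.prod_congr rfl fun i _ => by
    rw [Pi.smul_apply, smul_eq_mul, mul_comm, zpow_mul, zpow_natCast]

/-- `τ^(single j 1) = τ j`. [folklore] -/
theorem residChart_prod_zpow_single [DecidableEq ι] (τ : ι → Γ₀) (j : ι) :
    ∏ i, τ i ^ ((Pi.single j (1 : ℤ) : ι → ℤ) i) = τ j := by
  rw [Finset.prod_eq_single j (fun i _ hi => by rw [Pi.single_eq_of_ne hi, zpow_zero])
    (fun h => absurd (Finset.mem_univ j) h), Pi.single_eq_same, zpow_one]

/-- `τ^0 = 1` (pointwise-zero exponent). [folklore] -/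
theorem residChart_prod_zpow_zero (τ : ι → Γ₀) :
    ∏ i, τ i ^ ((0 : ι → ℤ) i) = 1 :=
  Finset.prod_eq_one fun i _ => by rw [Pi.zero_apply, zpow_zero]

/-- A Laurent monomial in non-zero values is positive. [folklore] -/
theorem residChart_prod_zpow_pos {Γ : Type*} [LinearOrderedCommGroupWithZero Γ] (τ : ι → Γ)
    (hτ : ∀ i, τ i ≠ 0) (m : ι → ℤ) : 0 < ∏ i, τ i ^ (m i) :=
  Finset.prod_pos fun i _ => zpow_pos (zero_lt_iff.mpr (hτ i)) _

end Monomials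

/-! ### Re-indexing along an enumeration of part of the parameters -/

section Extend

variable {n nS : ℕ} {P : Fin n → Prop} (e : Fin nS ≃ {i : Fin n // P i})

/-- The extension by zero of `m : Fin nS → ℤ` along `j ↦ e j` takes the value `m j` at `e j`.
[folklore] -/
theorem residChart_extend_apply_enum (m : Fin nS → ℤ) (j : Fin nS) :
    Function.extend (fun j => (e j).1) m 0 (e j).1 = m j :=
  (Subtype.val_injective.comp e.injective).extend_apply _ _ j

/-- The extension by zero vanishes off `P`. [folklore] -/
theorem residChart_extend_apply_of_not (m : Fin nS → ℤ) (i : Fin n) (hi : ¬ P i) :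
    Function.extend (fun j => (e j).1) m 0 i = 0 :=
  Function.extend_apply' _ _ _ fun ⟨j, hj⟩ => hi (hj ▸ (e j).2)

/-- Support control of the extension by zero. [folklore] -/
theorem residChart_extend_eq_zero (m : Fin nS → ℤ) (Q : Fin n → Prop)
    (hm : ∀ j, Q (e j).1 → m j = 0) (i : Fin n) (hi : Q i) :
    Function.extend (fun j => (e j).1) m 0 i = 0 := by
  by_cases hP : P i
  · obtain ⟨j, hj⟩ := e.surjective ⟨i, hP⟩
    have hji : (e j).1 = i := by rw [hj]
    subst hji
    rw [residChart_extend_apply_enum]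
    exact hm j hi
  · exact residChart_extend_apply_of_not e m i hP

/-- The extension by zero of a non-zero exponent is non-zero. [folklore] -/
theorem residChart_extend_ne_zero (m : Fin nS → ℤ) (hm : m ≠ 0) :
    Function.extend (fun j => (e j).1) m 0 ≠ 0 := by
  intro h
  apply hm
  funext j
  have := congrFun h (e j).1
  rwa [residChart_extend_apply_enum] at this

/-- Extending the restriction of an exponent vanishing off `P` gives it back. [folklore] -/
theorem residChart_extend_restrict (M : Fin n → ℤ) (hM : ∀ i, ¬ P i → M i = 0) :
    Function.extend (fun j => (e j).1) (fun j => M (e j).1) 0 = M := by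
  funext i
  by_cases hP : P i
  · obtain ⟨j, hj⟩ := e.surjective ⟨i, hP⟩
    have hji : (e j).1 = i := by rw [hj]
    rw [← hji, residChart_extend_apply_enum]
  · rw [residChart_extend_apply_of_not e _ i hP, hM i hP]

/-- A Laurent monomial whose exponent vanishes off `P` is a Laurent monomial in the enumerated
parameters. [folklore] -/
theorem residChart_prod_eq_prod_enum {Γ₀ : Type*} [CommGroupWithZero Γ₀] [DecidablePred P]
    (τ : Fin n → Γ₀) (M : Fin n → ℤ) (hM : ∀ i, ¬ P i → M i = 0) :
    ∏ i, τ i ^ (M i) = ∏ j, τ (e j).1 ^ (M (e j).1) := by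
  rw [← Fintype.prod_subtype_mul_prod_subtype P (fun i => τ i ^ (M i))]
  have h2 : ∏ i : {i // ¬ P i}, τ i.1 ^ (M i.1) = 1 :=
    Finset.prod_eq_one fun i _ => by rw [hM i.1 i.2, zpow_zero]
  rw [h2, mul_one]
  exact (Fintype.prod_equiv e _ _ fun j => rfl).symm

/-- The Laurent monomial of an extended exponent. [folklore] -/
theorem residChart_prod_extend {Γ₀ : Type*} [CommGroupWithZero Γ₀] [DecidablePred P]
    (τ : Fin n → Γ₀) (m : Fin nS → ℤ) :
    ∏ i, τ i ^ (Function.extend (fun j => (e j).1) m 0 i) = ∏ j, τ (e j).1 ^ (m j) := by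
  rw [residChart_prod_eq_prod_enum e τ _ (fun i hi => residChart_extend_apply_of_not e m i hi)]
  exact Finset.prod_congr rfl fun j _ => by rw [residChart_extend_apply_enum]

end Extend

/-! ### Units of `W` and their residues -/

section Units

variable {K : Type} [Field K]

/-- A `W`-unit lies in `W`. [folklore] -/
theorem residChart_mem_of_val_one (W : ValuationSubring K) {y : K} (hy : W.valuation y = 1) :
    y ∈ W :=
  (W.valuation_le_one_iff y).mp hy.le

/-- A `W`-unit is non-zero. [folklore] -/
theorem residChart_ne_zero_of_val_one (W : ValuationSubring K) {y : K} (hy : W.valuation y = 1) :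
    y ≠ 0 := by
  rintro rfl
  rw [map_zero] at hy
  exact zero_ne_one hy

/-- The inverse of a `W`-unit lies in `W`. [folklore] -/
theorem residChart_inv_mem_of_val_one (W : ValuationSubring K) {y : K} (hy : W.valuation y = 1) :
    y⁻¹ ∈ W := by
  rw [← W.valuation_le_one_iff, map_inv₀, hy, inv_one]

/-- A `W`-unit is a unit of `W`. [folklore] -/
theorem residChart_isUnit_of_val_one (W : ValuationSubring K) {y : K} (hy : W.valuation y = 1)
    (hyW : y ∈ W) : IsUnit (⟨y, hyW⟩ : W) :=
  (W.valuation_eq_one_iff _).mpr hy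

/-- An element of `W` with non-zero residue is a `W`-unit. [folklore] -/
theorem residChart_val_eq_one_of_residue_ne_zero (W : ValuationSubring K) {y : K} (hyW : y ∈ W)
    (h : residue W ⟨y, hyW⟩ ≠ 0) : W.valuation y = 1 :=
  (W.valuation_eq_one_iff ⟨y, hyW⟩).mp ((residue_ne_zero_iff_isUnit _).mp h)

variable (W : ValuationSubring K) {ι : Type*} [Fintype ι] (y : ι → K)
  (hy1 : ∀ i, W.valuation (y i) = 1)

include hy1 in
/-- A Laurent monomial in `W`-units is a `W`-unit. [folklore] -/
theorem residChart_val_prod_zpow_eq_one (m : ι → ℤ) : W.valuation (∏ i, y i ^ (m i)) = 1 := by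
  rw [map_prod]
  exact Finset.prod_eq_one fun i _ => by rw [map_zpow₀, hy1, one_zpow]

/-- **Residues of Laurent monomials in units.** The residue of `∏ yᵢ ^ mᵢ` (`yᵢ` units of `W`,
`mᵢ ∈ ℤ`) is `∏ ȳᵢ ^ mᵢ`. [folklore] -/
theorem residChart_residue_prod_zpow (m : ι → ℤ) (hmem : (∏ i, y i ^ (m i)) ∈ W) :
    residue W ⟨∏ i, y i ^ (m i), hmem⟩ =
      ∏ i, residue W ⟨y i, residChart_mem_of_val_one W (hy1 i)⟩ ^ (m i) := by
  set u : ι → Wˣ := fun i =>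
    (residChart_isUnit_of_val_one W (hy1 i) (residChart_mem_of_val_one W (hy1 i))).unit with hu
  have huW : ∀ i, (u i : W) = ⟨y i, residChart_mem_of_val_one W (hy1 i)⟩ := fun i =>
    IsUnit.unit_spec _
  have hprodW : ((∏ i, u i ^ (m i) : Wˣ) : W) = ⟨∏ i, y i ^ (m i), hmem⟩ := by
    apply Subtype.ext
    change (W.subtype.toMonoidHom.comp (Units.coeHom W)) (∏ i, u i ^ (m i)) = ∏ i, y i ^ (m i)
    rw [map_prod]
    refine Finset.prod_congr rfl fun i _ => ?_
    rw [map_zpow]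
    change (((u i : W) : K)) ^ (m i) = y i ^ (m i)
    rw [huW]
  have hres : residue W ((∏ i, u i ^ (m i) : Wˣ) : W) = ∏ i, residue W (u i : W) ^ (m i) := by
    change ((residue W).toMonoidHom.comp (Units.coeHom W)) (∏ i, u i ^ (m i)) = _
    rw [map_prod]
    exact Finset.prod_congr rfl fun i _ => by rw [map_zpow]; rfl
  rw [← hprodW, hres]
  exact Finset.prod_congr rfl fun i _ => by rw [huW]

/-- `ν̄` of the residue of a Laurent monomial in `W`-units is the Laurent monomial of the `ν̄(ȳᵢ)`.
[folklore] -/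
theorem residChart_val_residue_prod_zpow (S : ValuationSubring (ResidueField W)) (m : ι → ℤ)
    (hmem : (∏ i, y i ^ (m i)) ∈ W) :
    S.valuation (residue W ⟨∏ i, y i ^ (m i), hmem⟩) =
      ∏ i, S.valuation (residue W ⟨y i, residChart_mem_of_val_one W (hy1 i)⟩) ^ (m i) := by
  rw [residChart_residue_prod_zpow W y hy1 m hmem, map_prod]
  exact Finset.prod_congr rfl fun i _ => map_zpow₀ _ _ _

/-- **Dictionary for Laurent monomials, weak form**: for `W`-units `yᵢ`,
`∏ ν̄(ȳᵢ)^μᵢ ≤ ∏ ν̄(ȳᵢ)^mᵢ ↔ ∏ ν(yᵢ)^μᵢ ≤ ∏ ν(yᵢ)^mᵢ`. [folklore] -/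
theorem residChart_prod_val_residue_le_iff (O : ValuationSubring K) (hOW : O ≤ W) (μ m : ι → ℤ) :
    (∏ i, (residueValuationSubring O W hOW).valuation
        (residue W ⟨y i, residChart_mem_of_val_one W (hy1 i)⟩) ^ (μ i)) ≤
      ∏ i, (residueValuationSubring O W hOW).valuation
        (residue W ⟨y i, residChart_mem_of_val_one W (hy1 i)⟩) ^ (m i) ↔
    (∏ i, O.valuation (y i) ^ (μ i)) ≤ ∏ i, O.valuation (y i) ^ (m i) := by
  have hμ := residChart_val_prod_zpow_eq_one W y hy1 μ
  have hm := residChart_val_prod_zpow_eq_one W y hy1 m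
  rw [← residChart_val_residue_prod_zpow W y hy1 _ μ (residChart_mem_of_val_one W hμ),
    ← residChart_val_residue_prod_zpow W y hy1 _ m (residChart_mem_of_val_one W hm),
    ap_resval_le_iff O W hOW _ _ hm, map_prod, map_prod]
  constructor <;> intro h <;> convert h using 2 <;> simp [map_zpow₀]

/-- **Dictionary for Laurent monomials, strict form**: for `W`-units `yᵢ`,
`∏ ν̄(ȳᵢ)^μᵢ < ∏ ν̄(ȳᵢ)^mᵢ ↔ ∏ ν(yᵢ)^μᵢ < ∏ ν(yᵢ)^mᵢ`. [folklore] -/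
theorem residChart_prod_val_residue_lt_iff (O : ValuationSubring K) (hOW : O ≤ W) (μ m : ι → ℤ) :
    (∏ i, (residueValuationSubring O W hOW).valuation
        (residue W ⟨y i, residChart_mem_of_val_one W (hy1 i)⟩) ^ (μ i)) <
      ∏ i, (residueValuationSubring O W hOW).valuation
        (residue W ⟨y i, residChart_mem_of_val_one W (hy1 i)⟩) ^ (m i) ↔
    (∏ i, O.valuation (y i) ^ (μ i)) < ∏ i, O.valuation (y i) ^ (m i) := by
  rw [lt_iff_not_ge, lt_iff_not_ge, residChart_prod_val_residue_le_iff W y hy1 O hOW m μ]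

/-- **Dictionary, one unit against a Laurent monomial**: for `W`-units `yᵢ` and an index `i₀`,
`ν̄(ȳ_{i₀}) < ∏ ν̄(ȳᵢ)^mᵢ ↔ ν(y_{i₀}) < ∏ ν(yᵢ)^mᵢ`. [folklore] -/
theorem residChart_val_residue_lt_prod_iff (O : ValuationSubring K) (hOW : O ≤ W) (i₀ : ι)
    (m : ι → ℤ) :
    (residueValuationSubring O W hOW).valuation
        (residue W ⟨y i₀, residChart_mem_of_val_one W (hy1 i₀)⟩) <
      ∏ i, (residueValuationSubring O W hOW).valuation
        (residue W ⟨y i, residChart_mem_of_val_one W (hy1 i)⟩) ^ (m i) ↔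
    O.valuation (y i₀) < ∏ i, O.valuation (y i) ^ (m i) := by
  have hm := residChart_val_prod_zpow_eq_one W y hy1 m
  rw [← residChart_val_residue_prod_zpow W y hy1 _ m (residChart_mem_of_val_one W hm),
    ap_resval_lt_iff O W hOW _ _ (hy1 i₀), map_prod]
  constructor <;> intro h <;> convert h using 2 <;> simp [map_zpow₀]

end Units

/-! ### The lower parameters of a monomially cut-out coarsening -/

section Params

variable {K : Type} [Field K] (O W : ValuationSubring K) {n : ℕ}
  (S : Subring K) (x : Fin n → K) (hxS : ∀ i, x i ∈ S) (lv : Fin n → ℕ) (top : ℕ)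

/-- The parameters of level `< top` and their inverses lie in `W`. [folklore] -/
theorem residChart_param_mem_W
    (hW : ∀ z : K, z ∈ W ↔ ∃ m : Fin n → ℤ, (∀ j, top ≤ lv j → m j = 0) ∧
      O.valuation z ≤ ∏ j, O.valuation (x j) ^ (m j))
    (i : Fin n) (hi : lv i < top) : x i ∈ W ∧ (x i)⁻¹ ∈ W := by
  classical
  have hne : ∀ j, top ≤ lv j → j ≠ i := by
    rintro j hj rfl
    exact absurd hi (not_lt.mpr hj)
  constructor
  · rw [hW]
    refine ⟨Pi.single i 1, fun j hj => Pi.single_eq_of_ne (hne j hj) _, ?_⟩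
    rw [residChart_prod_zpow_single]
  · rw [hW]
    refine ⟨-Pi.single i 1, fun j hj => ?_, ?_⟩
    · rw [Pi.neg_apply, Pi.single_eq_of_ne (hne j hj), neg_zero]
    · rw [residChart_prod_zpow_neg, residChart_prod_zpow_single, map_inv₀]

/-- The parameters of level `< top` are `W`-units. [folklore] -/
theorem residChart_val_param_eq_one (hx0 : ∀ i, x i ≠ 0)
    (hW : ∀ z : K, z ∈ W ↔ ∃ m : Fin n → ℤ, (∀ j, top ≤ lv j → m j = 0) ∧
      O.valuation z ≤ ∏ j, O.valuation (x j) ^ (m j))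
    (i : Fin n) (hi : lv i < top) : W.valuation (x i) = 1 := by
  obtain ⟨h1, h2⟩ := residChart_param_mem_W O W x lv top hW i hi
  refine le_antisymm ((W.valuation_le_one_iff _).mpr h1) ?_
  have := (W.valuation_le_one_iff _).mpr h2
  rwa [map_inv₀, inv_le_one₀ ((Valuation.pos_iff _).mpr (hx0 i))] at this

/-- With all levels `≤ top`, "level `≥ top`" and "level `= top`" index the same parameters.
[folklore] -/
theorem residChart_range_top_eq (htop : ∀ i, lv i ≤ top) :
    (Set.range fun i : {i : Fin n // top ≤ lv i} => (⟨x i.1, hxS i.1⟩ : S)) =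
      Set.range fun i : {i : Fin n // lv i = top} => (⟨x i.1, hxS i.1⟩ : S) := by
  ext z
  constructor
  · rintro ⟨⟨i, hi⟩, rfl⟩
    exact ⟨⟨i, le_antisymm (htop i) hi⟩, rfl⟩
  · rintro ⟨⟨i, hi⟩, rfl⟩
    exact ⟨⟨i, hi.ge⟩, rfl⟩

end Params


/-- **Dictionary (b)** between residual values of `W`-units and `O`-values (registered anchor of
this helper file; the explicit-binder form of `ap_resval_le_iff` of `…APDict`): for `y ∈ W` and a
`W`-unit `y'`, `ν̄(ȳ) ≤ ν̄(ȳ') ↔ ν(y) ≤ ν(y')`. [folklore] -/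
theorem residChart_dictionary_b : ∀ (K : Type) [Field K] (O W : ValuationSubring K) (hOW : O ≤ W) (y y' : K) (hy : y ∈ W) (hy' : y' ∈ W), W.valuation y' = 1 → ((Literature.AlgebraicGeometry.Resolution.residueValuationSubring O W hOW).valuation (IsLocalRing.residue W ⟨y, hy⟩) ≤ (Literature.AlgebraicGeometry.Resolution.residueValuationSubring O W hOW).valuation (IsLocalRing.residue W ⟨y', hy'⟩) ↔ O.valuation y ≤ O.valuation y') :=
  fun _ _ O W hOW _ _ hy hy' h1 => ap_resval_le_iff O W hOW hy hy' h1

end Summit.ResolutionOfSingularities.ResolutionOfSingularities.Theorems.PfaffLine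

end
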